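import Literature.MathematicalPhysics.QuantumFieldTheory.Balaban1983to89.Beta.RemainderDecay190SupNormLeaves
import Literature.MathematicalPhysics.QuantumFieldTheory.Balaban1983to89.Beta.RemainderKernelPeriodised
import Literature.MathematicalPhysics.QuantumFieldTheory.Balaban1983to89.Beta.RemainderKernelDecay

/-!
# [Balaban1987RG1] (1.21) ∕ (5.10) with [Balaban1985Variational] (182) on the (4.4)-space MODEL: the three NODE-E
# kernel letters `hker` ∕ `hS` ∕ `hdec` of row (D4) are THEOREMS for a δ𝐇∕δB assembled by (182) from four periodised
# decaying ℤ^d pieces — the leaf list and the row-(D4) END in that currency (`Beta.RemainderDecay190SupNormPieces`)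

statement-level skeleton of published theorems with citation tags; proofs where landed; nothing here is a claim
about the Yang–Mills mass gap.

HONEST FRAMING (cell rule).  Bookkeeping for the k-uniform remainder chain of row (D4) (`RemainderConst` ⇐ ONE
`ChainTFac190` instance, `Beta.RemainderDecay190`); discharges NOTHING of `BetaPertH`; NOT B12 Thm 2, NOT the continuum
limit, NOT Clay.  Unit `b2b-balaban-beta-an4` gen 96 (BINDER row D4 OWNER; cell pub-balaban).  Imports the three
generation-95 files `Beta.RemainderDecay190SupNormLeaves` (NODE E complete on the model carrier: the leaf list
`PolLeavesTFac190H` and the END from object-level letters, among them the kernel letters `hS` ∕ `hdec` ∕ `hker`),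
`Beta.RemainderKernelPeriodised` (`entry_eq182`, `hker_of_entry`) and `Beta.RemainderKernelDecay` (`decay₂_eq182`) ONLY;
nothing edited.  ONE COMPOSITION, no new idea: the three files meet at the kernel letters.

WHAT.  `RemainderDecay190SupNormLeaves.nonempty_polLeavesTFac190H_supNorm` (generation 95) inhabits the leaf list of
row (D4) on the (4.4)-space model from object-level data, three of which are LETTERS about a family of ℤ^d kernels
`S Y` behind the kernel of (δ𝐇∕δB)_n: joint periodicity `hS`, exponential decay `hdec`, and the entrywise identity
`hker` *(the window entries of the kernel of (δ𝐇∕δB)_n are the entries of the periodisation of `S Y`)* — [I] (5.10)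
p. 293 ∕ (1.21) p. 264 shape.  [15] (182) p. 307 writes δ𝐇∕δB = (𝔄₀ + H₀) − H𝔇(𝔄₀ + H₀).  THIS FILE:
* §1 **`letters_of_pieces182`** — if the four Sect. G operators `𝔄₀`, `H₀`, `H`, `𝔇` on every torus of the sequence
  (`N n·M` sites per direction) act ENTRYWISE as the periodisations of four ℤ^d kernels `a₀`, `h₀`, `h`, `𝔡` that are
  periodic under every `N n·M` and decay at a common rate `δ₀ > 0`, and `dH n` is given by (182), then ALL THREE letters
  hold with ONE kernel for every window: `S Y := k₁₈₂ := (a₀ + h₀) + (−1)·(h ∘ (𝔡 ∘ (a₀ + h₀)))` (written with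
  `compKer`), `hS` from `entry_eq182` (row bounds from the decay, `Decay₂.rowBound`), `hker` from `hker_of_entry`, `hdec`
  from `decay₂_eq182` at rate `δ₀∕4` with its explicit constant.
* §2 **`nonempty_polLeavesTFac190H_supNorm_of_pieces182`** — generation 95's leaf-list theorem with the three kernel
  letters REPLACED by the piece data; the read-out `a Y z := Re ∂²(F Y)(0)[(k₁₈₂(e Y i, 0))_i, (k₁₈₂(e Y i, z))_i]` is
  WRITTEN in the conclusion.  `…_of_exists` takes the (190)-socket in generation 94's `∃ D, hrule` shape.
* §3 **`remainderConst_of_stepObjects_pieces182`** — the row-(D4) END per (scale, history) in this currency: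
  `RemainderConst S γ (ε₁ · K_rem,L(d, M, c, α₂, B₃(q)))` from step objects + seam + a (190)-socket on the model + window
  data + FOUR PERIODISED DECAYING PIECES assembled by (182) + the (1.22) identification against the written read-out.
AFTER THIS FILE, on the model carrier, the (5.10)-type input of row (D4) is no longer a letter about δ𝐇∕δB but a
statement about the four Sect. G PIECES at zero background: *each acts on the torus as the periodisation of a decaying
ℤ^d kernel* ([Balaban1984PropagatorsI] p. 36 *"relating G on the torus to G on the whole lattice in the usual way"*) —
a statement about NODE O's objects.  WHAT IS *NOT* DONE: no operator of Bałaban's is constructed; that HIS 𝔄₀, H₀, H, 𝔇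
are such periodisations is NODE O's business and is not asserted; row D4 class UNCHANGED (instance 0∕1; critical-path
width 0 = NODE O; D4 DISCHARGE NO DATE).  No `def`, no named fact, no `sorry`, standard axioms.
HONEST DEPENDENCY: continuum YM on T⁴ ⇐ BetaPertH ∧ nine spine estimates (0/9 proved); BetaPertH ⇐ (D1) ∧ (D4) ∧
CAP+tail; G-an2-4 gates asym, D1 and NE2/3/4.

Sources: [I] = T. Bałaban, *Renormalization group approach to lattice gauge field theories. I*, Commun. Math. Phys.
**109** (1987) 249–301 [Balaban1987RG1], (1.7) p. 261, (1.21)–(1.22) p. 264, (4.4) p. 281, (4.35) p. 290, (5.10)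
p. 293; [II] = T. Bałaban, Commun. Math. Phys. **116** (1988) 1–22 [Balaban1988RG2Cluster], p. 15, Lemma 3 (2.38)
p. 20; [15] = *The variational problem and background fields in renormalization group method for lattice gauge
theories*, Commun. Math. Phys. **102** (1985) 277–309 [Balaban1985Variational], (182) p. 307, (190) p. 308; [3] =
Commun. Math. Phys. **96** (1984) 223–250 [Balaban1984PropagatorsII], (2.61) p. 234; T. Bałaban, Commun. Math. Phys.
**95** (1984) 17–40 [Balaban1984PropagatorsI], p. 36.
-/

namespace Literature.MathematicalPhysics.QuantumFieldTheory.Balaban1983to89.Beta.RemainderDecay190SupNormPieces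

open Literature.MathematicalPhysics.QuantumFieldTheory.Balaban1983to89
open Literature.MathematicalPhysics.QuantumFieldTheory.Balaban1983to89.B13ScaleTransfer (Pt)
open Literature.MathematicalPhysics.QuantumFieldTheory.Balaban1983to89.TreeLengthTorus (TPt TDom proj)
open Literature.MathematicalPhysics.QuantumFieldTheory.Balaban1983to89.B12Decay510 (mixedDeriv)
open Literature.MathematicalPhysics.QuantumFieldTheory.Balaban1983to89.B12Decay510Lattice (cubeOf)
open Literature.MathematicalPhysics.QuantumFieldTheory.Balaban1983to89.B12Decay510Torus (tcubeOf)
open Literature.MathematicalPhysics.QuantumFieldTheory.Balaban1983to89.B11SectG (Eq182)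
open Literature.MathematicalPhysics.QuantumFieldTheory.Balaban1983to89.Beta.RemainderLimitTorus (LDom tproj limKernel)
open Literature.MathematicalPhysics.QuantumFieldTheory.Balaban1983to89.Beta.RemainderLocalityHolo (PolLeavesTFac190H)
open Literature.MathematicalPhysics.QuantumFieldTheory.Balaban1983to89.Beta.RemainderDecay190 (Data190 Consts190)
open Literature.MathematicalPhysics.QuantumFieldTheory.Balaban1983to89.Beta.RemainderChain (RemainderConst)
open Literature.MathematicalPhysics.QuantumFieldTheory.Balaban1983to89.Beta.RemainderChainLattice
  (CondsL SignsL remCoeffL)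
open Literature.MathematicalPhysics.QuantumFieldTheory.Balaban1983to89.Beta.RemainderStepAdapterHolo
  (StepObjectD4 remainderConst_of_leafLists)
open Literature.MathematicalPhysics.QuantumFieldTheory.Balaban1983to89.B12Sec2to5 (l1)
open Literature.MathematicalPhysics.QuantumFieldTheory.Balaban1983to89.Beta
  (Kernel₂ IsPeriodic₂ Decay₂ RowBound compKer periodise₂)
open Literature.MathematicalPhysics.QuantumFieldTheory.Balaban1983to89.Beta.RemainderLocalitySockets (restrictCLM)
open Literature.MathematicalPhysics.QuantumFieldTheory.Balaban1983to89.Beta.RemainderDecay190SupNormLeaves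
  (nonempty_polLeavesTFac190H_supNorm)
open Literature.MathematicalPhysics.QuantumFieldTheory.Balaban1983to89.Beta.RemainderKernelPeriodised
  (entry_eq182 hker_of_entry)
open Literature.MathematicalPhysics.QuantumFieldTheory.Balaban1983to89.Beta.RemainderKernelDecay (decay₂_eq182)
open Metric Set Filter Topology

variable {d : ℕ}

/-! ## 1. The three NODE-E kernel letters from four periodised decaying pieces assembled by (182) -/

section Letters

variable {M : ℕ} [NeZero M] {N : ℕ → ℕ} [∀ n, NeZero (N n)]

/-- **`hker`, `hS`, `hdec` FROM THE PIECES.**  Let `a₀`, `h₀`, `h`, `𝔡` be ℤ^d kernels decaying at a common rate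
`δ₀ > 0` and periodic under every period `N n·M` of the torus sequence; let the operators `𝔄₀ n`, `H₀ n`, `H n`, `𝔇 n`
on the `n`-th torus act entrywise as their periodisations ([Balaban1984PropagatorsI] p. 36 *"in the usual way"*), and
let `dH n` be given by (182): `dH = (𝔄₀ + H₀) − H𝔇(𝔄₀ + H₀)`.  Then, with the ONE kernel
`k₁₈₂ := (a₀ + h₀) + (−1)·(h ∘ (𝔡 ∘ (a₀ + h₀)))` for every window `Y` and window sites `e Y`: the entrywise identity
`hker` (the window entries of the kernel of `dH n` are the entries of the periodisation of `k₁₈₂`), the joint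
periodicity `hS`, and the decay `hdec` at rate `δ₀∕4` with the constant of `RemainderKernelDecay.decay₂_eq182` — the
three kernel letters of `RemainderDecay190SupNormLeaves.nonempty_polLeavesTFac190H_supNorm`, verbatim.
[cite: Balaban1985Variational, (182) p.307; Balaban1987RG1, (5.10) p.293, (1.21) p.264; Balaban1984PropagatorsI, p.36] -/
theorem letters_of_pieces182 {a₀ h₀ h 𝔡 : Kernel₂ d} {Ca Ch₀ Ch Cd δ₀ : ℝ}
    (ha : Decay₂ a₀ Ca δ₀) (hh₀ : Decay₂ h₀ Ch₀ δ₀) (hh : Decay₂ h Ch δ₀) (hd : Decay₂ 𝔡 Cd δ₀) (hδ₀ : 0 < δ₀)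
    (pa : ∀ n, IsPeriodic₂ (N n * M) a₀) (ph₀ : ∀ n, IsPeriodic₂ (N n * M) h₀) (ph : ∀ n, IsPeriodic₂ (N n * M) h)
    (pd : ∀ n, IsPeriodic₂ (N n * M) 𝔡)
    (dH A0 H0 Hk Dfr : (n : ℕ) → (TPt d (N n * M) → ℝ) →ₗ[ℝ] (TPt d (N n * M) → ℝ))
    (h182 : ∀ n, Eq182 (dH n) (A0 n) (H0 n) (Hk n) (Dfr n))
    (hA0 : ∀ n (a b : TPt d (N n * M)), A0 n (Pi.single b 1) a = periodise₂ (N n * M) a₀ a b)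
    (hH0 : ∀ n (a b : TPt d (N n * M)), H0 n (Pi.single b 1) a = periodise₂ (N n * M) h₀ a b)
    (hHk : ∀ n (a b : TPt d (N n * M)), Hk n (Pi.single b 1) a = periodise₂ (N n * M) h a b)
    (hDfr : ∀ n (a b : TPt d (N n * M)), Dfr n (Pi.single b 1) a = periodise₂ (N n * M) 𝔡 a b)
    {LD : Type*} {ι : LD → Type*} (e : (Y : LD) → ι Y → Pt d) :
    (∀ (Y : LD) (n : ℕ) (i : ι Y) (x : Pt d),
        dH n (Pi.single (proj (N n * M) x) (1 : ℝ)) (proj (N n * M) (e Y i)) =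
          periodise₂ (N n * M) ((a₀ + h₀) + fun x y => (-1) * compKer h (compKer 𝔡 (a₀ + h₀)) x y)
            (proj (N n * M) (e Y i)) (proj (N n * M) x)) ∧
      (∀ n, IsPeriodic₂ (N n * M) ((a₀ + h₀) + fun x y => (-1) * compKer h (compKer 𝔡 (a₀ + h₀)) x y)) ∧
      Decay₂ ((a₀ + h₀) + fun x y => (-1) * compKer h (compKer 𝔡 (a₀ + h₀)) x y)
        ((Ca + Ch₀) + |(-1 : ℝ)| *
          (Ch * (Cd * (Ca + Ch₀) * ∑' w : Fin d → ℤ, Real.exp (-(δ₀ - δ₀ / 2) * l1 w)) *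
            ∑' w : Fin d → ℤ, Real.exp (-(δ₀ / 2 - δ₀ / 4) * l1 w)))
        (δ₀ / 4) := by
  have E := fun n => entry_eq182 (h182 n) (hA0 n) (hH0 n) (hHk n) (hDfr n) (pa n) (ph₀ n) (ph n) (pd n)
    (ha.rowBound hδ₀) (hh₀.rowBound hδ₀) (hh.rowBound hδ₀) (hd.rowBound hδ₀)
  exact ⟨hker_of_entry dH (fun n a b => (E n).1 a b) e, fun n => (E n).2.1, decay₂_eq182 ha hh₀ hh hd hδ₀⟩

end Letters

/-! ## 2. The leaf list on the model carrier from the pieces -/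

section Leaves

variable {M : ℕ} [NeZero M]

/-- **`PolLeavesTFac190H` INHABITED ON THE (4.4)-SPACE MODEL WITH THE KERNEL LETTERS REPLACED BY FOUR PERIODISED
DECAYING PIECES ASSEMBLED BY (182).**  The hypotheses of `RemainderDecay190SupNormLeaves.nonempty_polLeavesTFac190H_supNorm`
— exhausting torus sequence, thin step objects with Lemma 3 (2.38) on their activities, `CondsL`, `0 ≤ C₃ε₁`, `0 < α₂`, a
seam into the analyticity domains along which the activities are ℂ-differentiable ([II] p. 15), a (190)-socket `D` on
the model whose (4.35) test vector is the restricted kernel column of `dH n` (`hrule`), window sites (finitely many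
distinct lattice sites inside the cubes of `Y`), window functionals with the eventual (1.7)-factorization `hfac` — with
`hS` ∕ `hdec` ∕ `hker` REPLACED by: four ℤ^d kernels `a₀`, `h₀`, `h`, `𝔡` decaying at a common rate `δ₀ > 0` and periodic
under every `N n·M`, four operator families acting entrywise as their periodisations, and (182) for `dH n`.  Output: the
leaf list with the read-out `a Y z := Re ∂²(F Y)(0)[(k₁₈₂(e Y i, 0))_i, (k₁₈₂(e Y i, z))_i]` WRITTEN.  Nothing of
Bałaban's is constructed.
[cite: Balaban1987RG1, (1.7) p.261, (1.21) p.264, (4.4) p.281, (4.35) p.290, (5.10) p.293; Balaban1988RG2Cluster, p.15 and (2.38) p.20; Balaban1985Variational, (182) p.307 and (190) p.308] -/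
theorem nonempty_polLeavesTFac190H_supNorm_of_pieces182 (N : ℕ → ℕ) [hN : ∀ n, NeZero (N n)]
    (hNlim : Tendsto N atTop atTop)
    (O : (n : ℕ) → StepObjectD4 d (N n)) (c : B13.Consts) (ℓ α₂ : ℝ) (q : Consts190)
    (h3 : ∀ n, (O n).Lemma3OnH c ℓ) (hC : CondsL d c ℓ) (hA : 0 ≤ c.C3act * c.ε₁) (hα₂ : 0 < α₂)
    (emb : (n : ℕ) → TDom d (N n) → (TPt d (N n * M) → ℂ) → (O n).Φ)
    (hemb : ∀ n X, ∀ v ∈ ball (0 : TPt d (N n * M) → ℂ) α₂, emb n X v ∈ (O n).sp2 X)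
    (hH : ∀ n (X Z : TDom d (N n)), Z.1 ⊆ X.1 →
      DifferentiableOn ℂ (fun v => (O n).H Z (emb n X v)) (ball 0 α₂))
    (D : Data190 d M N (fun n => TPt d (N n * M) → ℂ) q)
    (dH A0 H0 Hk Dfr : (n : ℕ) → (TPt d (N n * M) → ℝ) →ₗ[ℝ] (TPt d (N n * M) → ℝ))
    (hrule : ∀ (n : ℕ) (X : TDom d (N n)) (x : TPt d (N n * M)),
      D.hn n X x = fun x' : TPt d (N n * M) =>
        if tcubeOf (N n) M x' ∈ X.1 then ((dH n (Pi.single x (1 : ℝ)) x' : ℝ) : ℂ) else 0)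
    {ι : LDom d → Type} [∀ Y, Fintype (ι Y)] (e : (Y : LDom d) → ι Y → Pt d)
    (he : ∀ Y i, cubeOf M (e Y i) ∈ Y.1) (hinj : ∀ Y, Function.Injective (e Y))
    (F : (Y : LDom d) → (ι Y → ℂ) → ℂ)
    (hfac : ∀ Y : LDom d, ∀ᶠ n in atTop, ∀ v ∈ ball (0 : TPt d (N n * M) → ℂ) α₂,
      (O n).E (tproj (N n) Y) (emb n (tproj (N n) Y) v) = F Y (restrictCLM (N n * M) (e Y) v))
    -- the four periodised decaying pieces and (182)
    {a₀ h₀ h 𝔡 : Kernel₂ d} {Ca Ch₀ Ch Cd δ₀ : ℝ}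
    (ha : Decay₂ a₀ Ca δ₀) (hh₀ : Decay₂ h₀ Ch₀ δ₀) (hh : Decay₂ h Ch δ₀) (hd : Decay₂ 𝔡 Cd δ₀) (hδ₀ : 0 < δ₀)
    (pa : ∀ n, IsPeriodic₂ (N n * M) a₀) (ph₀ : ∀ n, IsPeriodic₂ (N n * M) h₀) (ph : ∀ n, IsPeriodic₂ (N n * M) h)
    (pd : ∀ n, IsPeriodic₂ (N n * M) 𝔡)
    (h182 : ∀ n, Eq182 (dH n) (A0 n) (H0 n) (Hk n) (Dfr n))
    (hA0 : ∀ n (a b : TPt d (N n * M)), A0 n (Pi.single b 1) a = periodise₂ (N n * M) a₀ a b)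
    (hH0 : ∀ n (a b : TPt d (N n * M)), H0 n (Pi.single b 1) a = periodise₂ (N n * M) h₀ a b)
    (hHk : ∀ n (a b : TPt d (N n * M)), Hk n (Pi.single b 1) a = periodise₂ (N n * M) h a b)
    (hDfr : ∀ n (a b : TPt d (N n * M)), Dfr n (Pi.single b 1) a = periodise₂ (N n * M) 𝔡 a b) :
    Nonempty (PolLeavesTFac190H d M
      (fun Y z => (mixedDeriv (F Y)
        (fun i => (((a₀ + h₀) + fun x y => (-1) * compKer h (compKer 𝔡 (a₀ + h₀)) x y) (e Y i) 0 : ℂ))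
        (fun i => (((a₀ + h₀) + fun x y => (-1) * compKer h (compKer 𝔡 (a₀ + h₀)) x y) (e Y i) z : ℂ))).re)
      c ℓ α₂ q) := by
  obtain ⟨hker, hS, hdec⟩ :=
    letters_of_pieces182 ha hh₀ hh hd hδ₀ pa ph₀ ph pd dH A0 H0 Hk Dfr h182 hA0 hH0 hHk hDfr e
  exact nonempty_polLeavesTFac190H_supNorm N hNlim O c ℓ α₂ q h3 hC hA hα₂ emb hemb hH D dH hrule e he hinj F hfac
    (S := fun _ => (a₀ + h₀) + fun x y => (-1) * compKer h (compKer 𝔡 (a₀ + h₀)) x y)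
    (fun _ n => hS n) (fun _ => hdec) (by positivity) hker

/-- **The same with the (190)-socket in generation 94's EXISTENCE shape** `∃ D, hrule` (the conclusion of
`RemainderDecay190SupNorm.exists_data190_of_sectG_blocks_supNorm` ∕ `_cubes_supNorm` verbatim).
[cite: Balaban1985Variational, (182)-(190) pp.307-308; Balaban1987RG1, (1.7) p.261, (1.21) p.264, (4.4) p.281, (5.10) p.293] -/
theorem nonempty_polLeavesTFac190H_supNorm_of_pieces182_of_exists (N : ℕ → ℕ) [hN : ∀ n, NeZero (N n)]
    (hNlim : Tendsto N atTop atTop)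
    (O : (n : ℕ) → StepObjectD4 d (N n)) (c : B13.Consts) (ℓ α₂ : ℝ) (q : Consts190)
    (h3 : ∀ n, (O n).Lemma3OnH c ℓ) (hC : CondsL d c ℓ) (hA : 0 ≤ c.C3act * c.ε₁) (hα₂ : 0 < α₂)
    (emb : (n : ℕ) → TDom d (N n) → (TPt d (N n * M) → ℂ) → (O n).Φ)
    (hemb : ∀ n X, ∀ v ∈ ball (0 : TPt d (N n * M) → ℂ) α₂, emb n X v ∈ (O n).sp2 X)
    (hH : ∀ n (X Z : TDom d (N n)), Z.1 ⊆ X.1 →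
      DifferentiableOn ℂ (fun v => (O n).H Z (emb n X v)) (ball 0 α₂))
    (dH A0 H0 Hk Dfr : (n : ℕ) → (TPt d (N n * M) → ℝ) →ₗ[ℝ] (TPt d (N n * M) → ℝ))
    (hD : ∃ D : Data190 d M N (fun n => TPt d (N n * M) → ℂ) q,
      ∀ (n : ℕ) (X : TDom d (N n)) (x : TPt d (N n * M)),
        D.hn n X x = fun x' : TPt d (N n * M) =>
          if tcubeOf (N n) M x' ∈ X.1 then ((dH n (Pi.single x (1 : ℝ)) x' : ℝ) : ℂ) else 0)
    {ι : LDom d → Type} [∀ Y, Fintype (ι Y)] (e : (Y : LDom d) → ι Y → Pt d)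
    (he : ∀ Y i, cubeOf M (e Y i) ∈ Y.1) (hinj : ∀ Y, Function.Injective (e Y))
    (F : (Y : LDom d) → (ι Y → ℂ) → ℂ)
    (hfac : ∀ Y : LDom d, ∀ᶠ n in atTop, ∀ v ∈ ball (0 : TPt d (N n * M) → ℂ) α₂,
      (O n).E (tproj (N n) Y) (emb n (tproj (N n) Y) v) = F Y (restrictCLM (N n * M) (e Y) v))
    {a₀ h₀ h 𝔡 : Kernel₂ d} {Ca Ch₀ Ch Cd δ₀ : ℝ}
    (ha : Decay₂ a₀ Ca δ₀) (hh₀ : Decay₂ h₀ Ch₀ δ₀) (hh : Decay₂ h Ch δ₀) (hd : Decay₂ 𝔡 Cd δ₀) (hδ₀ : 0 < δ₀)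
    (pa : ∀ n, IsPeriodic₂ (N n * M) a₀) (ph₀ : ∀ n, IsPeriodic₂ (N n * M) h₀) (ph : ∀ n, IsPeriodic₂ (N n * M) h)
    (pd : ∀ n, IsPeriodic₂ (N n * M) 𝔡)
    (h182 : ∀ n, Eq182 (dH n) (A0 n) (H0 n) (Hk n) (Dfr n))
    (hA0 : ∀ n (a b : TPt d (N n * M)), A0 n (Pi.single b 1) a = periodise₂ (N n * M) a₀ a b)
    (hH0 : ∀ n (a b : TPt d (N n * M)), H0 n (Pi.single b 1) a = periodise₂ (N n * M) h₀ a b)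
    (hHk : ∀ n (a b : TPt d (N n * M)), Hk n (Pi.single b 1) a = periodise₂ (N n * M) h a b)
    (hDfr : ∀ n (a b : TPt d (N n * M)), Dfr n (Pi.single b 1) a = periodise₂ (N n * M) 𝔡 a b) :
    Nonempty (PolLeavesTFac190H d M
      (fun Y z => (mixedDeriv (F Y)
        (fun i => (((a₀ + h₀) + fun x y => (-1) * compKer h (compKer 𝔡 (a₀ + h₀)) x y) (e Y i) 0 : ℂ))
        (fun i => (((a₀ + h₀) + fun x y => (-1) * compKer h (compKer 𝔡 (a₀ + h₀)) x y) (e Y i) z : ℂ))).re)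
      c ℓ α₂ q) := by
  obtain ⟨D, hrule⟩ := hD
  exact nonempty_polLeavesTFac190H_supNorm_of_pieces182 N hNlim O c ℓ α₂ q h3 hC hA hα₂ emb hemb hH D dH A0 H0 Hk Dfr
    hrule e he hinj F hfac ha hh₀ hh hd hδ₀ pa ph₀ ph pd h182 hA0 hH0 hHk hDfr

end Leaves

/-! ## 3. The row-(D4) END per (scale, history) from the pieces -/

section End

variable {M : ℕ} [NeZero M]

/-- **HOW (D4) CLOSES ON THE MODEL CARRIER FROM FOUR PERIODISED DECAYING PIECES PER (scale, history).**  For the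
β-family `β` with one-loop split `S` on the boxes `]0,γ]^{k+1}`: IF for every scale `k` and history `p` the object-level
data of `nonempty_polLeavesTFac190H_supNorm_of_pieces182_of_exists` are given — torus sequence, thin step objects with
(2.38), seam + H-layer holomorphy, a (190)-socket on the model in the `∃ D, hrule` shape for the (182)-composite `dH` of
four operator families that act entrywise as the periodisations of four ℤ^d kernels decaying at a common rate and
periodic under every torus period, window sites ∕ functionals with the (1.7)-factorization — AND `β¹_{k+1}(p)` is the
second moment of the limit kernel of the WRITTEN read-out ((1.22), `beta1_eq`), THEN
`|β¹_{k+1}(g_0,…,g_k)| ≤ ε₁ · K_rem,L(d, M, c, α₂, B₃(q))` on every box (`RemainderConst`), under N1–N3.  Nothing of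
Bałaban's is asserted.
[cite: Balaban1987RG1, (1.22) p.264, (1.7) p.261, (4.4) p.281 and (5.10) p.293; Balaban1988RG2Cluster, p.15 and (2.38) p.20; Balaban1985Variational, (182) p.307 and (190) p.308] -/
theorem remainderConst_of_stepObjects_pieces182 {μ ν : Fin d} {β : FlowStep.HBeta} (S : B12Beta.OneLoopSplit β)
    {γ : ℝ} {c : B13.Consts} {ℓ α₂ : ℝ} {q : Consts190}
    (hC : CondsL d c ℓ) (h22 : c.R22gen ℓ) (hq : q.Valid c.δ₀) (hs : SignsL c α₂ q.B₃)
    -- per (scale, history): the torus family, the step objects, (2.38), the seam, the H-layer datum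
    (N : (k : ℕ) → (Fin (k + 1) → ℝ) → ℕ → ℕ) (hN : ∀ k p n, NeZero (N k p n))
    (hNlim : ∀ k p, Tendsto (N k p) atTop atTop)
    (O : (k : ℕ) → (p : Fin (k + 1) → ℝ) → (n : ℕ) → StepObjectD4 d (N k p n))
    (h3 : ∀ k p n, (O k p n).Lemma3OnH c ℓ)
    (emb : (k : ℕ) → (p : Fin (k + 1) → ℝ) → (n : ℕ) → TDom d (N k p n) →
      (TPt d (N k p n * M) → ℂ) → (O k p n).Φ)
    (hemb : ∀ k p n X, ∀ v ∈ ball (0 : TPt d (N k p n * M) → ℂ) α₂, emb k p n X v ∈ (O k p n).sp2 X)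
    (hH : ∀ k p n (X Z : TDom d (N k p n)), Z.1 ⊆ X.1 →
      DifferentiableOn ℂ (fun v => (O k p n).H Z (emb k p n X v)) (ball 0 α₂))
    -- per (scale, history, torus): the four Sect. G operators, their (182)-composite, a (190)-socket with the (4.35) rule
    (dH A0 H0 Hk Dfr : (k : ℕ) → (p : Fin (k + 1) → ℝ) → (n : ℕ) →
      (TPt d (N k p n * M) → ℝ) →ₗ[ℝ] (TPt d (N k p n * M) → ℝ))
    (h182 : ∀ k p n, Eq182 (dH k p n) (A0 k p n) (H0 k p n) (Hk k p n) (Dfr k p n))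
    (hD : ∀ k p, ∃ D : Data190 d M (N k p) (fun n => TPt d (N k p n * M) → ℂ) q,
      ∀ (n : ℕ) (X : TDom d (N k p n)) (x : TPt d (N k p n * M)),
        D.hn n X x = fun x' : TPt d (N k p n * M) =>
          if tcubeOf (N k p n) M x' ∈ X.1 then ((dH k p n (Pi.single x (1 : ℝ)) x' : ℝ) : ℂ) else 0)
    -- the window: sites, functionals, (1.7)-factorization
    {ι : LDom d → Type} [∀ Y, Fintype (ι Y)] (e : (Y : LDom d) → ι Y → Pt d)
    (he : ∀ Y i, cubeOf M (e Y i) ∈ Y.1) (hinj : ∀ Y, Function.Injective (e Y))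
    (F : (k : ℕ) → (p : Fin (k + 1) → ℝ) → (Y : LDom d) → (ι Y → ℂ) → ℂ)
    (hfac : ∀ k p (Y : LDom d), ∀ᶠ n in atTop, ∀ v ∈ ball (0 : TPt d (N k p n * M) → ℂ) α₂,
      (O k p n).E (tproj (N k p n) Y) (emb k p n (tproj (N k p n) Y) v) =
        F k p Y (restrictCLM (N k p n * M) (e Y) v))
    -- per (scale, history): the four ℤ^d pieces, decaying at a common rate, periodic under every torus period
    (a₀ h₀ h 𝔡 : (k : ℕ) → (Fin (k + 1) → ℝ) → Kernel₂ d) (Ca Ch₀ Ch Cd δ₀ : (k : ℕ) → (Fin (k + 1) → ℝ) → ℝ)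
    (ha : ∀ k p, Decay₂ (a₀ k p) (Ca k p) (δ₀ k p)) (hh₀ : ∀ k p, Decay₂ (h₀ k p) (Ch₀ k p) (δ₀ k p))
    (hh : ∀ k p, Decay₂ (h k p) (Ch k p) (δ₀ k p)) (hd : ∀ k p, Decay₂ (𝔡 k p) (Cd k p) (δ₀ k p))
    (hδ₀ : ∀ k p, 0 < δ₀ k p)
    (pa : ∀ k p n, IsPeriodic₂ (N k p n * M) (a₀ k p)) (ph₀ : ∀ k p n, IsPeriodic₂ (N k p n * M) (h₀ k p))
    (ph : ∀ k p n, IsPeriodic₂ (N k p n * M) (h k p)) (pd : ∀ k p n, IsPeriodic₂ (N k p n * M) (𝔡 k p))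
    (hA0 : ∀ k p n (a b : TPt d (N k p n * M)), A0 k p n (Pi.single b 1) a = periodise₂ (N k p n * M) (a₀ k p) a b)
    (hH0 : ∀ k p n (a b : TPt d (N k p n * M)), H0 k p n (Pi.single b 1) a = periodise₂ (N k p n * M) (h₀ k p) a b)
    (hHk : ∀ k p n (a b : TPt d (N k p n * M)), Hk k p n (Pi.single b 1) a = periodise₂ (N k p n * M) (h k p) a b)
    (hDfr : ∀ k p n (a b : TPt d (N k p n * M)), Dfr k p n (Pi.single b 1) a = periodise₂ (N k p n * M) (𝔡 k p) a b)
    -- the (1.22) identification against the WRITTEN read-out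
    (beta1_eq : ∀ k p, p ∈ B12Beta.HistBox γ k →
      S.β1 k p = B12Beta.secondMoment (fun _ _ => limKernel fun Y z =>
        (mixedDeriv (F k p Y)
          (fun i => (((a₀ k p + h₀ k p) + fun x y =>
            (-1) * compKer (h k p) (compKer (𝔡 k p) (a₀ k p + h₀ k p)) x y) (e Y i) 0 : ℂ))
          (fun i => (((a₀ k p + h₀ k p) + fun x y =>
            (-1) * compKer (h k p) (compKer (𝔡 k p) (a₀ k p + h₀ k p)) x y) (e Y i) z : ℂ))).re) μ ν) :
    RemainderConst S γ (c.ε₁ * remCoeffL d M c α₂ q.B₃) :=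
  remainderConst_of_leafLists S
    (fun k p Y z => (mixedDeriv (F k p Y)
      (fun i => (((a₀ k p + h₀ k p) + fun x y =>
        (-1) * compKer (h k p) (compKer (𝔡 k p) (a₀ k p + h₀ k p)) x y) (e Y i) 0 : ℂ))
      (fun i => (((a₀ k p + h₀ k p) + fun x y =>
        (-1) * compKer (h k p) (compKer (𝔡 k p) (a₀ k p + h₀ k p)) x y) (e Y i) z : ℂ))).re)
    beta1_eq
    (fun k p _ => (nonempty_polLeavesTFac190H_supNorm_of_pieces182_of_exists (hN := hN k p) (N k p) (hNlim k p)
      (O k p) c ℓ α₂ q (h3 k p) hC hs.A hs.α₂_pos (emb k p) (hemb k p) (hH k p) (dH k p) (A0 k p) (H0 k p) (Hk k p)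
      (Dfr k p) (hD k p) e he hinj (F k p) (hfac k p) (ha k p) (hh₀ k p) (hh k p) (hd k p) (hδ₀ k p) (pa k p)
      (ph₀ k p) (ph k p) (pd k p) (h182 k p) (hA0 k p) (hH0 k p) (hHk k p) (hDfr k p)).some)
    hC h22 hq hs

end End

end Literature.MathematicalPhysics.QuantumFieldTheory.Balaban1983to89.Beta.RemainderDecay190SupNormPieces
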